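import Summits.BirchSwinnertonDyer.Rank1Residual.ManinAdditive.DegeneracyClassEulerUnitTwistConverse
import Summits.BirchSwinnertonDyer.Rank1Residual.ManinAdditive.DegeneracyClassEulerWitnesses
import HarnessLib
import HarnessLib.Audit.Tags

/-!
# E-es-93 at `D.f` ⟺ a PRIME-conductor polar unit twist (es g22 LEMMA C, W-level; PROVED)
# (cell `bsd-f2-manin`, T-es-29 (i′), typer g15)

Cell `bsd-f2-manin` (D-0131 (3) frontier), lens es, planner es g22 MEMO-es §36.16 («PROVED (5)» 2026-08-28T21:00:47Z); landed
by the cell typer g15 VERBATIM from HOME/es/Sketch-es-g22-thm87.lean sha16 1fa952104aa82908 §WLevelLemmaC (file lines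
2189–2253; the predicate `PrimeThreeAdicPolarWitness` itself is in the leaf `DegeneracyClassEulerLaws`): **THE W-LEVEL
EQUIVALENCE** `degeneracyClassNineEulerList_iff_primeThreeAdicPolarWitness` — for a modular parametrisation `D` of `W`, the
instance of the law E-es-93 at `D.f` (E-translated prime-class ratio-`9` loops for the list of sharp primes, `a_q = a_q(W)`)
is EQUIVALENT to `PrimeThreeAdicPolarWitness W D.f` (the tree's `ThreeAdicPolarWitness W W f` restricted to prime conductors
`m ≡ 2 (mod 3)`, `ρ = 1`, Euler product verbatim) — and the corollary `threeAdicPolarWitness_of_primeThreeAdicPolarWitness`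
(a prime-conductor polar unit twist gives the tree's witness for `W` additive at `3`).  Namespace `BsdF2ManinEsG22T` ↦
`…ManinAdditive.KatoCurve`.  TYPER EDGE (PROVED, 3 lines): the additivity binders discharged from `9 ∣ N`
(`threeAdicPolarWitness_of_primeThreeAdicPolarWitness_of_nine_dvd`, via `additive_of_sq_dvd_level 3`) — so the C3 LEAD may type
the es-input h66 EITHER as E-es-93 OR as «`9 ∣ N → PlusIndexPrimeTo 3 D.f → PrimeThreeAdicPolarWitness W D.f`» (TURNKEY-es-19:
provably equivalent instance-wise).

EVERYTHING HERE IS A SORRY-FREE THEOREM (no law, no fact).  REF1 §R91 (R-es-43/44 ANSWERED 2026-08-28T21:14:26Z + ADDENDUM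
21:15:38Z, HOME/ref1/R91-ref1-es-g22.md 800686d5a3b62d5b, PH99c 3eac233f102109bf): es thm87 1fa952104aa82908 re-elaborated rc 0,
19/19 axioms standard incl. the four LEMMA C theorems, BC7 4/4 CLEAN; E-es-91/92/93 SURVIVE as laws; «E-es-93|_{D.f} ⟺
PrimeThreeAdicPolarWitness, so E43 = instances» CONFIRMED — this covers the whole T-es-29 (h)(h′)(i′) landing
(`DegeneracyClassEulerLaws` / `…UnitTwist` / `…Witnesses` / `…UnitTwistConverse`, whose headers still say PENDING: read §R91).  bears_on: stmt-BirchSwinnertonDyer-22968.  PARTITION 0 · beyond-print theorem: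
es says YES (lemma-level) · BSD is not proved by this; Manin's conjecture is not proved by this.
-/

noncomputable section

open scoped Classical MatrixGroups ModularForm ComplexConjugate

open CongruenceSubgroup Complex Literature.NumberTheory.EllipticCurves
  Literature.NumberTheory.EllipticCurves.ModularForms
open Summit.BirchSwinnertonDyer.Rank1Residual.ManinAdditive.KatoCurve
open Summit.BirchSwinnertonDyer.Rank1Residual.ManinAdditive.Gamma1Lattice

namespace Summit.BirchSwinnertonDyer.Rank1Residual.ManinAdditive.KatoCurve

section WLevelLemmaC

open WeierstrassCurve

/-- **THE W-LEVEL EQUIVALENCE (es g22; PROVED).**  For a modular parametrisation `D` of `W`, the instance of the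
law E-es-93 at `D.f` (E-translated prime-class ratio-`9` loops for the list of sharp primes, `a_q = a_q(W)`) is
EQUIVALENT to a prime-conductor polar unit twist `PrimeThreeAdicPolarWitness W D.f`. -/
theorem degeneracyClassNineEulerList_iff_primeThreeAdicPolarWitness (W : WeierstrassCurve ℚ) [W.IsElliptic]
    {N : ℕ} [NeZero N] (D : ModularParametrizationData W N) :
    DegeneracyClassEulerListPlusIndexPrimeTo D.f 3 9
        (N.primeFactors.filter fun q => ¬ q ^ 2 ∣ N).toList (fun q => W.LFunction q)
      ↔ PrimeThreeAdicPolarWitness W D.f := by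
  have hΩC : (plusPeriod D.f : ℂ) ≠ 0 := by
    exact_mod_cast (IsNewform0.plusPeriod_pos_holds D.isNewformOf.1 D.isNewformOf.coeffField_eq_bot).ne'
  constructor
  · intro hd
    obtain ⟨m, hm, hmp, hm3, h9N, hL, χ, r, hcop, -, -, hord, h9, hev, hr, hu⟩ :=
      exists_prime_eulerListUnitTwist_of_degeneracyClass D.f 9 _ _ D.isNewformOf.1
        D.isNewformOf.coeffField_eq_bot hd
    have h33 : (3 : ZMod m) * 3 = ((9 : ℕ) : ZMod m) := by push_cast; norm_num
    have h9' : χ (3 : ZMod m) * χ (3 : ZMod m) ≠ 1 := by rw [← map_mul, h33]; exact h9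
    have h3a : χ (3 : ZMod m) ≠ 1 := fun h => h9' (by rw [h, mul_one])
    have h3b : χ (3 : ZMod m) ≠ -1 := fun h => h9' (by rw [h]; norm_num)
    refine ⟨m, hm, χ, r, hmp, hm3, (Nat.Prime.coprime_iff_not_dvd hmp).mp hcop, hord, h3a, h3b, hev, ?_, hu⟩
    rw [eulerFactorList_eq_prod, Finset.prod_map_toList] at hr
    exact hr
  · rintro ⟨m, hm, χ, r, hmp, hm3, h3N, hord, h3a, h3b, hev, hr, hu⟩
    haveI : Fact m.Prime := ⟨hmp⟩
    have hm3' : m ≠ 3 := by rintro rfl; exact h3N (dvd_mul_right 3 N)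
    have hmN : ¬ m ∣ N := fun h => h3N (Dvd.dvd.mul_left h 3)
    have h9N : ¬ m ∣ 9 * N := by
      intro h
      rcases (Nat.Prime.dvd_mul hmp).mp h with h9 | hN
      · have : m ∣ 3 ^ 2 := by norm_num; exact h9
        exact hm3' ((Nat.prime_dvd_prime_iff_eq hmp Nat.prime_three).mp (hmp.dvd_of_dvd_pow this))
      · exact hmN hN
    have hL : ∀ q ∈ (N.primeFactors.filter fun q => ¬ q ^ 2 ∣ N).toList, ¬ m ∣ q := by
      intro q hq hmq
      rw [Finset.mem_toList, Finset.mem_filter] at hq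
      have hqp : q.Prime := Nat.prime_of_mem_primeFactors hq.1
      have hqN : q ∣ N := Nat.dvd_of_mem_primeFactors hq.1
      have hmq' : m = q := (Nat.prime_dvd_prime_iff_eq hmp hqp).mp hmq
      exact hmN (hmq' ▸ hqN)
    have h33 : (3 : ZMod m) * 3 = ((9 : ℕ) : ZMod m) := by push_cast; norm_num
    have h9 : χ ((9 : ℕ) : ZMod m) ≠ 1 := by
      rw [← h33, map_mul]
      intro h
      rcases mul_self_eq_one_iff.mp h with h1 | h1
      · exact h3a h1
      · exact h3b h1
    refine degeneracyClassEulerList_of_primeUnitTwist D.f 9 _ _ D.isNewformOf.1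
      D.isNewformOf.coeffField_eq_bot hm3 h9N hL hev hord h9 ?_
    intro s hs
    rw [eulerFactorList_eq_prod, Finset.prod_map_toList]
    have : (s : ℂ) * ((∏ ℓ ∈ N.primeFactors with ¬ ℓ ^ 2 ∣ N, eulerFactorTwist ℓ (W.LFunction ℓ) χ) *
        twistedSymbolSum D.f χ / (plusPeriod D.f : ℂ)) / 3 = (s : ℂ) * r / 3 := by
      rw [show (∏ ℓ ∈ N.primeFactors with ¬ ℓ ^ 2 ∣ N, eulerFactorTwist ℓ (W.LFunction ℓ) χ) *
          twistedSymbolSum D.f χ = r * (plusPeriod D.f : ℂ) from hr, mul_div_cancel_right₀ _ hΩC]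
    rw [this]
    exact hu s hs

/-- **COROLLARY (es g22; PROVED).**  A prime-conductor polar unit twist gives the tree's witness for `W` additive
at `3` — and, by the equivalence, is exactly what the law E-es-93 asserts at `D.f`. -/
theorem threeAdicPolarWitness_of_primeThreeAdicPolarWitness (W : WeierstrassCurve ℚ) [W.IsElliptic]
    {N : ℕ} [NeZero N] (D : ModularParametrizationData W N)
    (h3g : ¬ W.HasGoodReductionAtPrime 3) (h3m : ¬ W.HasMultiplicativeReductionAtPrime 3)
    (hW : PrimeThreeAdicPolarWitness W D.f) : ThreeAdicPolarWitness W W D.f :=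
  threeAdicPolarWitness_of_degeneracyClassNineEulerList W D h3g h3m
    ((degeneracyClassNineEulerList_iff_primeThreeAdicPolarWitness W D).mpr hW)

/-- **Typer edge (PROVED):** a prime-conductor polar unit twist at a level `9 ∣ N` gives the tree's
`ThreeAdicPolarWitness W W D.f`, the additivity of `W` at `3` being read off `9 ∣ N` (`additive_of_sq_dvd_level 3`). -/
theorem threeAdicPolarWitness_of_primeThreeAdicPolarWitness_of_nine_dvd (W : WeierstrassCurve ℚ) [W.IsElliptic]
    {N : ℕ} [NeZero N] (D : ModularParametrizationData W N) (h9 : 3 ^ 2 ∣ N)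
    (hW : PrimeThreeAdicPolarWitness W D.f) : ThreeAdicPolarWitness W W D.f := by
  haveI : Fact (Nat.Prime 3) := ⟨Nat.prime_three⟩
  obtain ⟨h3g, h3m⟩ := additive_of_sq_dvd_level 3 W D.f D.isNewformOf h9
  exact threeAdicPolarWitness_of_primeThreeAdicPolarWitness W D h3g h3m hW

end WLevelLemmaC

end Summit.BirchSwinnertonDyer.Rank1Residual.ManinAdditive.KatoCurve

end
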